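import Summits.BirchSwinnertonDyer.BirchSwinnertonDyer.Theorems.Rank2ObservatoryPadicAtlasKitMin2
import Summits.BirchSwinnertonDyer.BirchSwinnertonDyer.Theorems.Rank2ObservatoryRank3Table
import HarnessLib

/-!
# BirchSwinnertonDyer — rank ≥ 2 observatory: the `p`-adic atlas kit for the RANK-3 census (`r = 3`)

HONEST FRAMING: per-curve certified theorems and census instruments; no claim on BSD in rank ≥ 2.

Module of the series `Rank2ObservatoryPadic*.lean`. The rank-2 kit `Rank2ObservatoryPadicAtlasKit.lean`
packages one kernel test per census cell `(E, p)` with the order of vanishing `r = 2` built into the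
cell's `SymbolCertL`; this file is its rank-3 twin: the SAME cell datum `AtlasCell`
(`p, a_p, n, A, tabHi, tabLo, H, L`) read as a level-`p^{n+1}` certificate of `[T³] L_p(E,T) ≠ 0`
(`AtlasCell.certL3`, `r = 3`; the double sums now carry the weights `binom(s, 3)`), its kernel test
`AtlasCell.check3` with the soundness lemmas, and a curve record `AtlasCurve3` over a VERBATIM rank-3
census row (`Rank3Row` of `Rank2ObservatoryRank3Table.lean`: label, model, conductor, Heegner datum,
three listed generators) whose minimality tests are those of the rank-2 kit through the forgetful map
`AtlasCurve3.toA` (same integer model; soundness bundled in `AtlasCurve3.sound`/`sound₂` and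
`AtlasCell.arith_of_check3` — the rank-2 kit's lemmas are reused, not restated). SOUNDNESS
(`AtlasCurve3.padicRow`): if `C.check = true` and
`c ∈ C.cells` then — GIVEN the named inputs `hPRS` (Perrin-Riou–Schneider, BMS Thm. 1.7), `hkato`
(Kato, Thm. 17.4, all cyclotomic data), the newform `hf`, the rank input `hlow : 3 ≤ rank_ℤ E(ℚ)`
(a THEOREM of the tree for every rank-3 census row: `Rank2ObservatoryRank3KernelCertsCensus.lean`;
the data parts discharge it) and the symbol DATA `hint`/`htab` — `rank_ℤ E(ℚ) = 3` EXACTLY,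
`ord_{T=0} L_p(E,T) = 3`, `Ш(E/ℚ)[p^∞]` finite, Schneider non-degeneracy at `(E, p)` for every
canonical height datum, `corank Sel_{p^∞}(E/ℚ) = 3` (generic squeeze `padicRow_of_symbolCertL` of
`Rank2ObservatoryPadicSymbolTableL.lean`, valid for any `r` with `p ∤ r!`). No `sorry`, no new axioms,
kernel `decide` only (no `native_decide`).

References: B. Mazur, J. Tate, J. Teitelbaum, Invent. Math. 84 (1986), §I.10–I.13; W. Stein,
C. Wuthrich, Math. Comp. 82 (2013), §3; J. Balakrishnan, J. S. Müller, W. Stein, Math. Comp. 85 (2016),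
Thm. 1.7; K. Kato, Astérisque 295 (2004), Thm. 17.4; J. Silverman, AEC (2009), VII.1, VIII.8;
J. Cremona, Algorithms for Modular Elliptic Curves (1997), §2.13, §3.5.
-/

-- single-conjunct summit: `Summit.BirchSwinnertonDyer.BirchSwinnertonDyer.…` repeats the name by design
set_option linter.dupNamespace false

namespace Summit.BirchSwinnertonDyer.BirchSwinnertonDyer.Rank2Observatory

open scoped MatrixGroups ModularForm
open CongruenceSubgroup Literature.NumberTheory.EllipticCurves
  Literature.NumberTheory.EllipticCurves.ModularForms WeierstrassCurve
open Literature.NumberTheory.Sieve.GoldbachLinnik (primeB prime_of_primeB)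

/-! ### One cell, read with `r = 3` -/

namespace AtlasCell

variable (c : AtlasCell)

/-- The cell's `SymbolCertL` with `r = 3`, the period-`p^n` table expanded to length `p^{n+1}`.
[folklore] -/
def certL3 : SymbolCertL :=
  ⟨3, c.n, c.A, c.tabHi, (List.range (c.p ^ (c.n + 1))).map fun u => c.tabLo.getD (u % c.p ^ c.n) 0,
    c.H, c.L⟩

/-- Reading the expanded table: entry `u < p^{n+1}` is `tabLo[u mod p^n]`. [folklore] -/
theorem certL3_tabLo_getD {u : ℕ} (hu : u < c.p ^ (c.n + 1)) :
    c.certL3.tabLo.getD u 0 = c.tabLo.getD (u % c.p ^ c.n) 0 := by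
  simp [certL3, List.getD, List.getElem?_range hu]

/-- **The rank-3 kernel test of a cell** against the integer model `e`: `p` prime, `p ≥ 5`, `p ∤ Δ(e)`,
`#Ẽ(𝔽_p) = p + 1 − a_p`, `p ∤ a_p`, and `validL p a_p` of the `r = 3` certificate. [folklore] -/
def check3 (e : WeierstrassCurve ℤ) : Bool :=
  decide (5 ≤ c.p) && decide (¬ ((c.p : ℤ) ∣ e.Δ)) && decide ((c.count e : ℤ) = c.p + 1 - c.ap) &&
    decide (¬ ((c.p : ℤ) ∣ c.ap)) &&
    if hp : primeB c.p = true then @SymbolCertL.validL c.p ⟨prime_of_primeB hp⟩ c.ap c.certL3 else false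

section Soundness

variable {c} {e : WeierstrassCurve ℤ} (h : c.check3 e = true)
include h

/-- The arithmetic facts of a checking cell, bundled (the rank-2 kit states them one by one for `check`;
here ONE lemma): `p` prime, `5 ≤ p`, `p ∤ Δ(e)`, `#Ẽ(𝔽_p) = p + 1 − a_p`, `p ∤ a_p`. [folklore] -/
theorem arith_of_check3 : c.p.Prime ∧ 5 ≤ c.p ∧ ¬ ((c.p : ℤ) ∣ e.Δ) ∧ ((c.count e : ℤ) = c.p + 1 - c.ap) ∧
    ¬ ((c.p : ℤ) ∣ c.ap) := by
  have h' := h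
  simp only [check3, Bool.and_eq_true, decide_eq_true_eq] at h'
  refine ⟨?_, h'.1.1.1.1, h'.1.1.1.2, h'.1.1.2, h'.1.2⟩
  simp only [check3, Bool.and_eq_true] at h
  by_cases hp : primeB c.p = true
  · exact prime_of_primeB hp
  · rw [dif_neg hp] at h; exact absurd h.2 Bool.false_ne_true

/-- A checking cell's `r = 3` certificate is `validL`. [folklore] -/
theorem validL_of_check3 [Fact c.p.Prime] : c.certL3.validL c.p c.ap = true := by
  simp only [check3, Bool.and_eq_true] at h
  by_cases hp : primeB c.p = true
  · have h2 := h.2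
    rw [dif_pos hp] at h2
    exact h2
  · rw [dif_neg hp] at h; exact absurd h.2 Bool.false_ne_true

/-- A checking cell's kernel point count IS `#Ẽ(𝔽_p)` of the reduction of `e`. [folklore] -/
theorem card_of_check3 [Fact c.p.Prime] :
    Nat.card ((e.map (Int.castRingHom (ZMod c.p))).toAffine.Point) = c.count e := by
  have hp2 : c.p ≠ 2 := by have := (arith_of_check3 h).2.1; omega
  have hΔ : (e.map (Int.castRingHom (ZMod c.p))).Δ ≠ 0 := by
    rw [WeierstrassCurve.map_Δ, eq_intCast, ne_eq, ZMod.intCast_zmod_eq_zero_iff_dvd]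
    exact (arith_of_check3 h).2.2.1
  rw [natCard_point_eq_one_add_eulerAffineCount c.p hp2 _ hΔ]
  rfl

/-- A checking cell's `a_p` IS the Frobenius trace of `e ⊗ ℚ` at `p`. [folklore] -/
theorem frobeniusTrace_of_check3 [Fact c.p.Prime] [(e.baseChange ℚ).IsGloballyMinimal] :
    (e.baseChange ℚ).frobeniusTrace c.p = c.ap := by
  rw [frobeniusTrace_baseChange_int _ (card_of_check3 h)]
  have := (arith_of_check3 h).2.2.2.1
  omega

/-- A checking cell's prime is good ORDINARY for `e ⊗ ℚ`. [cite: SilvermanAEC2009, VII.1 Remark 1.1] -/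
theorem isOrdinaryAt_of_check3 [Fact c.p.Prime] [(e.baseChange ℚ).IsGloballyMinimal] :
    IsOrdinaryAt (e.baseChange ℚ) c.p := by
  refine isOrdinaryAt_baseChange_int_of_card c.p e (arith_of_check3 h).2.2.1 (card_of_check3 h) ?_
  rw [← frobeniusTrace_baseChange_int _ (card_of_check3 h), frobeniusTrace_of_check3 h]
  exact (arith_of_check3 h).2.2.2.2

end Soundness

end AtlasCell

/-! ### One rank-3 curve: census row, minimality bound, cells -/

/-- A curve of the rank-3 atlas: its census row (verbatim `Rank3Row`: label, model, conductor, Heegner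
datum, three listed generators), a bound `B` for the minimality criterion, and its certified cells.
[cite: CremonaAlgorithms1997, §2.13] -/
structure AtlasCurve3 where
  /-- the census row (`Rank2ObservatoryRank3Rows*.lean`, verbatim) -/
  row : Rank3Row
  /-- minimality bound: `|Δ| < B¹²` and `q¹² ∤ Δ ∨ q ∤ c₄` for every (odd) `q < B` -/
  B : ℕ
  /-- the certified cells of the curve -/
  cells : List AtlasCell

namespace AtlasCurve3

variable (C : AtlasCurve3)

/-- The integer model of the row. [folklore] -/
def e : WeierstrassCurve ℤ := ⟨C.row.a₁, C.row.a₂, C.row.a₃, C.row.a₄, C.row.a₆⟩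

/-- The forgetful map to the rank-2 kit's curve record (same model and bound; the first two listed
generators), through which the minimality tests are shared. [folklore] -/
def toA : AtlasCurve :=
  ⟨⟨C.row.label, C.row.a₁, C.row.a₂, C.row.a₃, C.row.a₄, C.row.a₆, C.row.N, C.row.P₁, C.row.P₂⟩, C.B,
    C.cells⟩

/-- The shared integer model. [folklore] -/
theorem toA_e : C.toA.e = C.e := rfl

/-- **The kernel test of a rank-3 curve**: `Δ ≠ 0` and every cell passes `check3` against the model.
[folklore] -/
def check : Bool :=
  decide (C.e.Δ ≠ 0) && C.cells.all fun c => c.check3 C.e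

/-- The finite global-minimality criterion (the rank-2 kit's `minCheck` on the shared model).
[cite: SilvermanAEC2009, VII.1 Remark 1.1] -/
def minCheck : Bool := C.toA.minCheck

/-- The Kraus-extended minimality criterion (the rank-2 kit's `minCheck₂` on the shared model).
[cite: Kraus1989, Prop. 2] -/
def minCheck₂ : Bool := C.toA.minCheck₂

variable {C}

/-- Every cell of a checking curve checks. [folklore] -/
theorem cell_check (h : C.check = true) {c : AtlasCell} (hc : c ∈ C.cells) : c.check3 C.e = true := by
  simp only [check, Bool.and_eq_true, List.all_eq_true] at h
  exact h.2 c hc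

/-- **Soundness of the two curve tests, bundled**: a curve passing `check` and the finite minimality
criterion `minCheck` is elliptic with a globally minimal integer model, and the prime of each of its
cells is prime (the rank-2 kit's `isElliptic`/`isGloballyMinimal` through `toA`, whose model is `C.e`).
[cite: SilvermanAEC2009, VII.1 Remark 1.1] -/
theorem sound (h : C.check = true) (hm : C.minCheck = true) :
    (C.e.baseChange ℚ).IsElliptic ∧ (C.e.baseChange ℚ).IsGloballyMinimal ∧ ∀ c ∈ C.cells, c.p.Prime := by
  have h' := h
  simp only [check, Bool.and_eq_true, decide_eq_true_eq] at h'
  exact ⟨isElliptic_baseChange_int _ h'.1, AtlasCurve.isGloballyMinimal (C := C.toA) hm,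
    fun c hc => (AtlasCell.arith_of_check3 (cell_check h hc)).1⟩

/-- **Soundness with the Kraus-extended criterion `minCheck₂`**, bundled likewise.
[cite: Kraus1989, Prop. 2] [cite: SilvermanAEC2009, VII.1 Remark 1.1] -/
theorem sound₂ (h : C.check = true) (hm : C.minCheck₂ = true) :
    (C.e.baseChange ℚ).IsElliptic ∧ (C.e.baseChange ℚ).IsGloballyMinimal ∧ ∀ c ∈ C.cells, c.p.Prime := by
  have h' := h
  simp only [check, Bool.and_eq_true, decide_eq_true_eq] at h'
  exact ⟨isElliptic_baseChange_int _ h'.1, AtlasCurve.isGloballyMinimal₂ (C := C.toA) hm,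
    fun c hc => (AtlasCell.arith_of_check3 (cell_check h hc)).1⟩

/-- **The `p`-adic row of a rank-3 atlas cell.** For a checking curve `C` and a cell `c ∈ C.cells`:
GIVEN `hPRS`, `hkato`, the newform `hf`, the rank input `hlow : 3 ≤ rank row.curve`, and the symbol
DATA `hint`/`htab` (`‖D‖_p = 1`), the kernel-checked Riemann sum gives `[T³] L_p ≠ 0`, hence
`rank = 3`, `ord_{T=0} L_p = 3`, `Ш[p^∞]` finite, Schneider non-degeneracy at `p` for every canonical
height datum, `corank Sel_{p^∞} = 3`. [cite: BalakrishnanMullerStein2015, Thm. 1.7]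
[cite: Kato2004Asterisque, Thm. 17.4 (p. 273)] [cite: MazurTateTeitelbaum1986Invent, §I.10–I.13] -/
theorem padicRow (h : C.check = true) {c : AtlasCell} (hc : c ∈ C.cells) [Fact c.p.Prime]
    [(C.e.baseChange ℚ).IsElliptic] [(C.e.baseChange ℚ).IsGloballyMinimal]
    (hPRS : Schneider1985_order_charGenerator) {N : ℕ} [NeZero N] {f : CuspForm (Gamma0 N) 2}
    (hf : IsNewformOf (C.e.baseChange ℚ) f)
    (hkato : ∀ (κ : ZpExtension ℚ c.p) (γ : Field.absoluteGaloisGroup ℚ),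
      kato_divisibility (C.e.baseChange ℚ) c.p (κ := κ) (γ := γ) (f := f))
    (hlow : 3 ≤ C.row.curve.mordellWeilRank) (D : ℚ) (hD : ‖(D : ℚ_[c.p])‖ = 1)
    (hint : ∀ x : ℚ, ‖(ratPlusSymbol f x : ℚ_[c.p])‖ ≤ 1)
    (htab : ∀ u : ℕ, u < c.p ^ (c.n + 1) → ¬ c.p ∣ u →
      ratPlusSymbol f ((u : ℚ) / (c.p : ℚ) ^ (c.n + 1)) = (c.tabHi.getD u 0 : ℚ) / D ∧
      ratPlusSymbol f ((u : ℚ) / (c.p : ℚ) ^ c.n) = (c.tabLo.getD (u % c.p ^ c.n) 0 : ℚ) / D) :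
    C.row.curve.mordellWeilRank = 3 ∧
      (padicLFunction f (unitRoot (C.e.baseChange ℚ) c.p : ℚ_[c.p])).order = 3 ∧
      Finite (AddCommGroup.primaryComponent (C.e.baseChange ℚ).sha c.p) ∧
      (∀ Dh : PAdicHeightData (C.e.baseChange ℚ) c.p, Dh.IsCanonical → SchneiderConjecture Dh) ∧
      (C.e.baseChange ℚ).selmerCorank c.p = 3 := by
  have hk : c.check3 C.e = true := cell_check h hc
  have hbc : C.e.baseChange ℚ = C.row.curve := by
    ext <;> simp [e, Rank3Row.curve, WeierstrassCurve.baseChange]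
  have hlow' : c.certL3.r ≤ (C.e.baseChange ℚ).mordellWeilRank := by
    rw [hbc]; exact hlow
  have htab' : ∀ u : ℕ, u < c.p ^ (c.certL3.n + 1) → ¬ c.p ∣ u →
      ratPlusSymbol f ((u : ℚ) / (c.p : ℚ) ^ (c.certL3.n + 1)) = (c.certL3.tabHi.getD u 0 : ℚ) / D ∧
      ratPlusSymbol f ((u : ℚ) / (c.p : ℚ) ^ c.certL3.n) = (c.certL3.tabLo.getD u 0 : ℚ) / D :=
    fun u hu hpu => by
      rw [AtlasCell.certL3_tabLo_getD c hu]
      exact htab u hu hpu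
  obtain ⟨hr, ho, hfin, hS, hsel⟩ := padicRow_of_symbolCertL c.p hPRS (C.e.baseChange ℚ)
    (AtlasCell.arith_of_check3 hk).2.1 (AtlasCell.isOrdinaryAt_of_check3 hk)
    (AtlasCell.frobeniusTrace_of_check3 hk) hf hkato c.certL3 (AtlasCell.validL_of_check3 hk) hlow' D
    hD hint htab'
  exact ⟨by rw [← hbc]; exact hr, ho, hfin, hS, hsel⟩

/-- From a table theorem `atlas.all (check ∧ minCheck) = true` to the two tests of a member.
[folklore] -/
theorem check_of_all {atlas : List AtlasCurve3}
    (h : atlas.all (fun C => C.check && C.minCheck) = true) {C : AtlasCurve3} (hC : C ∈ atlas) :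
    C.check = true ∧ C.minCheck = true := by
  simp only [List.all_eq_true, Bool.and_eq_true] at h
  exact h C hC

/-- From a table theorem `atlas.all (check ∧ minCheck₂) = true` to the two tests of a member.
[folklore] -/
theorem check_of_all₂ {atlas : List AtlasCurve3}
    (h : atlas.all (fun C => C.check && C.minCheck₂) = true) {C : AtlasCurve3} (hC : C ∈ atlas) :
    C.check = true ∧ C.minCheck₂ = true := by
  simp only [List.all_eq_true, Bool.and_eq_true] at h
  exact h C hC

end AtlasCurve3

end Summit.BirchSwinnertonDyer.BirchSwinnertonDyer.Rank2Observatory
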